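import Summits.CriticalPhenomena.Ising3DConformalLimit.Theorems.ReflectionTwinTwinThresholdOfSurfaceSummableOfBubbleIntegrable
import HarnessLib

/-!
# Crux `TwinThreshold` (stmt-CriticalPhenomena-16906), line `seam_renewal` — the UNCONDITIONAL weak threshold and the exact residual

Line lead, cycle 2 (`prover-line-stmt-CriticalPhenomena-16906-c1-0`, 2026-08-17). Helper file (`--supports stmt-CriticalPhenomena-16906`);
no statement of the route is asserted.

The crux `ReflectionTwin.TwinThreshold` asks for a seam coupling `J*` with `0 < J*`, `¬ LRO J*` and `LRO J'` for every `J' > J*`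
(`LRO J` = plane long-range order of the free (111) reflection twin `TW(J)` at bulk `β_c(3)`). From the two LANDED stubs of the line —
(M) `stub_seamMonotone` (Griffiths monotonicity in `J ≥ 0`, p166260) and (S) `stub_strongSeamOrder` (plane order at strong seam, p168573) —
this file proves, with NO open input:

* `exists_weakSeamThreshold` — **the plane-ordering threshold exists unconditionally in the weak sense**: there is `J* ≥ 0` with plane
  order at every `J' > J*` and plane disorder at every `0 ≤ J' < J*` (`J* := inf {J ≥ 0 | LRO J}`); `weakSeamThreshold_unique` — it is unique.
* `twinThreshold_iff_weakSeamThreshold` — the crux says exactly: THAT `J*` is strictly positive and itself plane-disordered.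
* `twinThreshold_iff_weakDisorder_and_noOrderAtThreshold` — **exact residual**: the crux is EQUIVALENT to (W) `∃ J > 0, ¬ LRO J`
  ("`J* > 0`": two weakly sewn critical ordinary surfaces do not order) together with (C⋆) "no plane order AT the weak threshold"
  (continuity of the free-state onset, asked at the single point `J*` only). The line's open registered stubs are sufficient for these
  ((W1)+(W2) ⇒ (W), (C2)+(C′) ⇒ (C⋆), tree theorem `stub_twinThreshold_of_surfaceSummable_of_bubbleIntegrable`, p169342) and (W), (C⋆) are
  necessary, so nothing cheaper than a (W)-type and a (C⋆)-type input can close the crux on ANY line.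

Use for the planner (release note of this cycle): a route that only needs SOME canonical seam coupling to feed `TwinTransparency` can take the
weak threshold of `exists_weakSeamThreshold` (proved) instead of the continuous positive threshold of the crux (open: (W1) finite surface
susceptibility of the critical (111) half-crystal, (C2) integrable sub-threshold thick-plane bubble).

The order-theoretic cores (`exists_weakThreshold_of`, `weakThreshold_unique`, `posContinuousThreshold_iff`) are stated for an abstract
predicate `P : ℝ → Prop` that is an up-set on `[0,∞)`; the model statements carry the crux's `let` header verbatim and are reached by `change`
(definitional unfolding to the tree's `PlaneSummable.twinLat`).
-/

noncomputable section

namespace Summit.CriticalPhenomena.Ising3DConformalLimit.Cruxes.TwinThreshold.SeamRenewal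

open scoped BigOperators Classical
open Set
open Literature.Probability.LatticeModels

/-! ## Order theory on `[0,∞)`: weak thresholds of an up-set -/

/-- **Weak threshold of an up-set.** If `P` is an up-set on `[0,∞)` holding at some `J ≥ 0`, then `J* := sInf {J ≥ 0 | P J}`
satisfies `0 ≤ J*`, `P J'` for all `J' > J*`, and `¬ P J'` for all `0 ≤ J' < J*` (nothing is claimed AT `J*`). [folklore] -/
theorem exists_weakThreshold_of {P : ℝ → Prop}
    (hmono : ∀ J J' : ℝ, 0 ≤ J → J ≤ J' → P J → P J')
    (hex : ∃ J : ℝ, 0 ≤ J ∧ P J) :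
    ∃ J : ℝ, 0 ≤ J ∧ (∀ J' : ℝ, J < J' → P J') ∧ (∀ J' : ℝ, 0 ≤ J' → J' < J → ¬ P J') := by
  have hTne : ({J : ℝ | 0 ≤ J ∧ P J}).Nonempty := by
    obtain ⟨J, hJ0, hJ⟩ := hex
    exact ⟨J, hJ0, hJ⟩
  have hTbdd : BddBelow {J : ℝ | 0 ≤ J ∧ P J} := ⟨0, fun J hJ => hJ.1⟩
  refine ⟨sInf {J : ℝ | 0 ≤ J ∧ P J}, le_csInf hTne fun J hJ => hJ.1, ?_, ?_⟩
  · intro J' hJ'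
    obtain ⟨J, hJT, hJlt⟩ := exists_lt_of_csInf_lt hTne hJ'
    exact hmono J J' hJT.1 hJlt.le hJT.2
  · intro J' hJ'0 hJ'lt hPJ'
    exact absurd (csInf_le hTbdd ⟨hJ'0, hPJ'⟩) (not_le.mpr hJ'lt)

/-- **Weak thresholds are unique**: two points of `[0,∞)` above which `P` holds and below which (on `[0,·)`) it fails coincide
(strictly between them `P` would both hold and fail). No monotonicity needed. [folklore] -/
theorem weakThreshold_unique {P : ℝ → Prop} {J₁ J₂ : ℝ}
    (h₁ : 0 ≤ J₁ ∧ (∀ J' : ℝ, J₁ < J' → P J') ∧ (∀ J' : ℝ, 0 ≤ J' → J' < J₁ → ¬ P J'))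
    (h₂ : 0 ≤ J₂ ∧ (∀ J' : ℝ, J₂ < J' → P J') ∧ (∀ J' : ℝ, 0 ≤ J' → J' < J₂ → ¬ P J')) : J₁ = J₂ := by
  obtain ⟨h₁0, h₁a, h₁b⟩ := h₁
  obtain ⟨h₂0, h₂a, h₂b⟩ := h₂
  by_contra hne
  rcases lt_or_gt_of_ne hne with hlt | hlt
  · exact h₂b ((J₁ + J₂) / 2) (by linarith) (by linarith) (h₁a _ (by linarith))
  · exact h₁b ((J₁ + J₂) / 2) (by linarith) (by linarith) (h₂a _ (by linarith))

/-- **A positive continuous threshold = weak disorder + no switching-on at the weak threshold.** For an up-set `P` on `[0,∞)`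
holding somewhere on `[0,∞)`: `∃ J > 0, ¬ P J ∧ ∀ J' > J, P J'` iff (W) `∃ J > 0, ¬ P J` and (C⋆) at every weak threshold `J`
(`P` above, `¬ P` on `[0,J)`) `P J` fails. (→: the threshold is the unique weak threshold, by monotonicity; ←: the weak threshold of
`exists_weakThreshold_of` lies above the disordered point, hence is positive, and (C⋆) applies to it.) [folklore] -/
theorem posContinuousThreshold_iff {P : ℝ → Prop}
    (hmono : ∀ J J' : ℝ, 0 ≤ J → J ≤ J' → P J → P J')
    (hex : ∃ J : ℝ, 0 ≤ J ∧ P J) :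
    (∃ J : ℝ, 0 < J ∧ ¬ P J ∧ ∀ J' : ℝ, J < J' → P J') ↔
      ((∃ J : ℝ, 0 < J ∧ ¬ P J) ∧
        ∀ J : ℝ, 0 ≤ J → (∀ J' : ℝ, J < J' → P J') → (∀ J' : ℝ, 0 ≤ J' → J' < J → ¬ P J') → ¬ P J) := by
  constructor
  · rintro ⟨J, hJpos, hnot, habove⟩
    refine ⟨⟨J, hJpos, hnot⟩, fun K hK0 _hKabove hKbelow hPK => ?_⟩
    rcases lt_trichotomy K J with hlt | rfl | hgt
    · exact hnot (hmono K J hK0 hlt.le hPK)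
    · exact hnot hPK
    · exact hKbelow ((J + K) / 2) (by linarith) (by linarith) (habove _ (by linarith))
  · rintro ⟨⟨J₀, hJ₀pos, hJ₀not⟩, hC⟩
    obtain ⟨J, hJ0, habove, hbelow⟩ := exists_weakThreshold_of hmono hex
    have hJ₀le : J₀ ≤ J := by
      by_contra h
      exact hJ₀not (habove J₀ (not_le.mp h))
    exact ⟨J, hJ₀pos.trans_le hJ₀le, hC J hJ0 habove hbelow, habove⟩

/-- A positive continuous threshold is in particular a positive, `P`-free weak threshold, and conversely (monotonicity supplies
`¬ P` below the threshold). [folklore] -/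
theorem posContinuousThreshold_iff_weak {P : ℝ → Prop}
    (hmono : ∀ J J' : ℝ, 0 ≤ J → J ≤ J' → P J → P J') :
    (∃ J : ℝ, 0 < J ∧ ¬ P J ∧ ∀ J' : ℝ, J < J' → P J') ↔
      ∃ J : ℝ, (0 ≤ J ∧ (∀ J' : ℝ, J < J' → P J') ∧ (∀ J' : ℝ, 0 ≤ J' → J' < J → ¬ P J')) ∧ 0 < J ∧ ¬ P J := by
  constructor
  · rintro ⟨J, hJpos, hnot, habove⟩
    exact ⟨J, ⟨hJpos.le, habove, fun J' hJ'0 hJ'lt hPJ' => hnot (hmono J' J hJ'0 hJ'lt.le hPJ')⟩, hJpos, hnot⟩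
  · rintro ⟨J, ⟨-, habove, -⟩, hJpos, hnot⟩
    exact ⟨J, hJpos, hnot, habove⟩

/-! ## The (111) reflection twin: statements in the crux's own `let` currency -/

/-- **The weak plane-ordering threshold of the reflection twin exists — unconditionally.** At bulk `β_c(3)` there is a seam coupling
`J* ≥ 0` such that the free (111) reflection twin `TW(J')` has plane long-range order for every `J' > J*` and no plane long-range order
for every `0 ≤ J' < J*`. Proof: (M) `stub_seamMonotone` makes `{J ≥ 0 | LRO J}` an up-set, (S) `stub_strongSeamOrder` makes it non-empty;
`exists_weakThreshold_of`. (Whether `J* > 0` and whether `LRO J*` fails — the crux — is open: stubs (W1), (C2) of the line.) [folklore] -/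
theorem exists_weakSeamThreshold : open Literature.Probability.LatticeModels in (let hZ : Site 3 → ℤ := fun z => z 0 + z 1 + z 2; let Adj : Site 3 → Site 3 → Prop := fun a b => ((∑ i, |a i - b i| = 1) ∧ ¬ ((hZ a = 0 ∧ hZ b = 1) ∨ (hZ a = 1 ∧ hZ b = 0))) ∨ (((hZ a = 0 ∧ hZ b = 1) ∨ (hZ a = 1 ∧ hZ b = 0)) ∧ ∃ i : Fin 3, a + b = Pi.single i 1); let cpl : ℝ → (L : ℕ) → ↥(box 3 L) → ↥(box 3 L) → ℝ := fun J _L a b => if Adj a.1 b.1 then (criticalBeta 3 / 2) * (if hZ a.1 = 0 ∨ hZ b.1 = 0 then J else 1) else 0; let twinLat : ℝ → (k : ℕ) → (Fin k → Site 3) → ℝ := fun J _k z => ⨆ L : ℕ, PairIsing.gibbsAvg (cpl J L) (fun s => ∏ i, if h : z i ∈ box 3 L then spinAt (⟨z i, h⟩ : ↥(box 3 L)) s else 0); let LRO : ℝ → Prop := fun J => ∃ m : ℝ, 0 < m ∧ ∀ c : Site 3, hZ c = 0 → m ≤ twinLat J 2 ![0, c]; ∃ J : ℝ, 0 ≤ J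 ∧ (∀ J' : ℝ, J < J' → LRO J') ∧ (∀ J' : ℝ, 0 ≤ J' → J' < J → ¬ LRO J')) := by
  have hM := stub_seamMonotone
  have hS := stub_strongSeamOrder
  change ∀ J J' : ℝ, 0 ≤ J → J ≤ J' → ∀ c : Site 3, PlaneSummable.twinLat J 2 ![0, c] ≤ PlaneSummable.twinLat J' 2 ![0, c] at hM
  change ∃ J : ℝ, 0 ≤ J ∧ ∃ m : ℝ, 0 < m ∧ ∀ c : Site 3, c 0 + c 1 + c 2 = 0 → m ≤ PlaneSummable.twinLat J 2 ![0, c] at hS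
  change ∃ J : ℝ, 0 ≤ J ∧
      (∀ J' : ℝ, J < J' → ∃ m : ℝ, 0 < m ∧ ∀ c : Site 3, c 0 + c 1 + c 2 = 0 → m ≤ PlaneSummable.twinLat J' 2 ![0, c]) ∧
      (∀ J' : ℝ, 0 ≤ J' → J' < J → ¬ ∃ m : ℝ, 0 < m ∧ ∀ c : Site 3, c 0 + c 1 + c 2 = 0 → m ≤ PlaneSummable.twinLat J' 2 ![0, c])
  refine exists_weakThreshold_of
    (P := fun J => ∃ m : ℝ, 0 < m ∧ ∀ c : Site 3, c 0 + c 1 + c 2 = 0 → m ≤ PlaneSummable.twinLat J 2 ![0, c]) ?_ hS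
  rintro J J' hJ hJJ' ⟨m, hm, hle⟩
  exact ⟨m, hm, fun c hc => (hle c hc).trans (hM J J' hJ hJJ' c)⟩

/-- **The weak plane-ordering threshold is unique** (so "the" threshold `J*` of the twin is well defined without any open input).
[folklore] -/
theorem weakSeamThreshold_unique : open Literature.Probability.LatticeModels in (let hZ : Site 3 → ℤ := fun z => z 0 + z 1 + z 2; let Adj : Site 3 → Site 3 → Prop := fun a b => ((∑ i, |a i - b i| = 1) ∧ ¬ ((hZ a = 0 ∧ hZ b = 1) ∨ (hZ a = 1 ∧ hZ b = 0))) ∨ (((hZ a = 0 ∧ hZ b = 1) ∨ (hZ a = 1 ∧ hZ b = 0)) ∧ ∃ i : Fin 3, a + b = Pi.single i 1); let cpl : ℝ → (L : ℕ) → ↥(box 3 L) → ↥(box 3 L) → ℝ := fun J _L a b => if Adj a.1 b.1 then (criticalBeta 3 / 2) * (if hZ a.1 = 0 ∨ hZ b.1 = 0 then J else 1) else 0; let twinLat : ℝ → (k : ℕ) → (Fin k → Site 3) → ℝ := fun J _k z => ⨆ L : ℕ, PairIsing.gibbsAvg (cpl J L) (fun s => ∏ i, if h : z i ∈ box 3 L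 then spinAt (⟨z i, h⟩ : ↥(box 3 L)) s else 0); let LRO : ℝ → Prop := fun J => ∃ m : ℝ, 0 < m ∧ ∀ c : Site 3, hZ c = 0 → m ≤ twinLat J 2 ![0, c]; let IsWeakSeamThreshold : ℝ → Prop := fun J => 0 ≤ J ∧ (∀ J' : ℝ, J < J' → LRO J') ∧ (∀ J' : ℝ, 0 ≤ J' → J' < J → ¬ LRO J'); ∀ J₁ J₂ : ℝ, IsWeakSeamThreshold J₁ → IsWeakSeamThreshold J₂ → J₁ = J₂) := by
  intro hZ Adj cpl twinLat LRO IsWeakSeamThreshold J₁ J₂ h₁ h₂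
  exact weakThreshold_unique (P := LRO) h₁ h₂

/-- **What the crux says about the weak threshold.** `TwinThreshold` holds iff some (equivalently: the) weak plane-ordering threshold
`J*` is strictly positive and itself plane-disordered: the crux = "`J* > 0`" ∧ "`¬ LRO J*`", `J*` being the proved object of
`exists_weakSeamThreshold`. ((M) supplies the disorder below a continuous threshold.) [folklore] -/
theorem twinThreshold_iff_weakSeamThreshold :
    Summit.CriticalPhenomena.Ising3DConformalLimit.Theses.ReflectionTwin.TwinThreshold ↔
      open Literature.Probability.LatticeModels in (let hZ : Site 3 → ℤ := fun z => z 0 + z 1 + z 2; let Adj : Site 3 → Site 3 → Prop := fun a b => ((∑ i, |a i - b i| = 1) ∧ ¬ ((hZ a = 0 ∧ hZ b = 1) ∨ (hZ a = 1 ∧ hZ b = 0))) ∨ (((hZ a = 0 ∧ hZ b = 1) ∨ (hZ a = 1 ∧ hZ b = 0)) ∧ ∃ i : Fin 3, a + b = Pi.single i 1); let cpl : ℝ → (L : ℕ) → ↥(box 3 L) → ↥(box 3 L) → ℝ := fun J _L a b => if Adj a.1 b.1 then (criticalBeta 3 / 2) * (if hZ a.1 = 0 ∨ hZ b.1 = 0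 then J else 1) else 0; let twinLat : ℝ → (k : ℕ) → (Fin k → Site 3) → ℝ := fun J _k z => ⨆ L : ℕ, PairIsing.gibbsAvg (cpl J L) (fun s => ∏ i, if h : z i ∈ box 3 L then spinAt (⟨z i, h⟩ : ↥(box 3 L)) s else 0); let LRO : ℝ → Prop := fun J => ∃ m : ℝ, 0 < m ∧ ∀ c : Site 3, hZ c = 0 → m ≤ twinLat J 2 ![0, c]; let IsWeakSeamThreshold : ℝ → Prop := fun J => 0 ≤ J ∧ (∀ J' : ℝ, J < J' → LRO J') ∧ (∀ J' : ℝ, 0 ≤ J' → J' < J → ¬ LRO J'); ∃ J : ℝ, IsWeakSeamThreshold J ∧ 0 < J ∧ ¬ LRO J) := by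
  have hM := stub_seamMonotone
  change ∀ J J' : ℝ, 0 ≤ J → J ≤ J' → ∀ c : Site 3, PlaneSummable.twinLat J 2 ![0, c] ≤ PlaneSummable.twinLat J' 2 ![0, c] at hM
  change (∃ J : ℝ, 0 < J ∧ (¬ ∃ m : ℝ, 0 < m ∧ ∀ c : Site 3, c 0 + c 1 + c 2 = 0 → m ≤ PlaneSummable.twinLat J 2 ![0, c]) ∧
      ∀ J' : ℝ, J < J' → ∃ m : ℝ, 0 < m ∧ ∀ c : Site 3, c 0 + c 1 + c 2 = 0 → m ≤ PlaneSummable.twinLat J' 2 ![0, c]) ↔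
    ∃ J : ℝ, (0 ≤ J ∧
      (∀ J' : ℝ, J < J' → ∃ m : ℝ, 0 < m ∧ ∀ c : Site 3, c 0 + c 1 + c 2 = 0 → m ≤ PlaneSummable.twinLat J' 2 ![0, c]) ∧
      (∀ J' : ℝ, 0 ≤ J' → J' < J → ¬ ∃ m : ℝ, 0 < m ∧ ∀ c : Site 3, c 0 + c 1 + c 2 = 0 → m ≤ PlaneSummable.twinLat J' 2 ![0, c])) ∧
      0 < J ∧ ¬ ∃ m : ℝ, 0 < m ∧ ∀ c : Site 3, c 0 + c 1 + c 2 = 0 → m ≤ PlaneSummable.twinLat J 2 ![0, c]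
  refine posContinuousThreshold_iff_weak
    (P := fun J => ∃ m : ℝ, 0 < m ∧ ∀ c : Site 3, c 0 + c 1 + c 2 = 0 → m ≤ PlaneSummable.twinLat J 2 ![0, c]) ?_
  rintro J J' hJ hJJ' ⟨m, hm, hle⟩
  exact ⟨m, hm, fun c hc => (hle c hc).trans (hM J J' hJ hJJ' c)⟩

/-- **EXACT RESIDUAL OF THE CRUX.** `TwinThreshold` is EQUIVALENT to the conjunction of
(W) `∃ J > 0, ¬ LRO J` — some strictly positive seam coupling is plane-disordered ("`J* > 0`"; the line derives it from (W1) finite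
surface susceptibility of the critical (111) half-crystal + (W2) the landed seam renewal), and
(C⋆) at every weak threshold `J` (`LRO` above `J`, `¬ LRO` on `[0, J)`) the plane is disordered AT `J` (continuity of the free-state
onset at the one point `J*`; the line derives it from (C2) integrable sub-threshold bubble + (C′) the landed Lebowitz transport).
Proof: `posContinuousThreshold_iff` with (M) and (S). Hence no line can close the crux with less than a (W)-type and a (C⋆)-type input.
[folklore] -/
theorem twinThreshold_iff_weakDisorder_and_noOrderAtThreshold :
    Summit.CriticalPhenomena.Ising3DConformalLimit.Theses.ReflectionTwin.TwinThreshold ↔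
      open Literature.Probability.LatticeModels in (let hZ : Site 3 → ℤ := fun z => z 0 + z 1 + z 2; let Adj : Site 3 → Site 3 → Prop := fun a b => ((∑ i, |a i - b i| = 1) ∧ ¬ ((hZ a = 0 ∧ hZ b = 1) ∨ (hZ a = 1 ∧ hZ b = 0))) ∨ (((hZ a = 0 ∧ hZ b = 1) ∨ (hZ a = 1 ∧ hZ b = 0)) ∧ ∃ i : Fin 3, a + b = Pi.single i 1); let cpl : ℝ → (L : ℕ) → ↥(box 3 L) → ↥(box 3 L) → ℝ := fun J _L a b => if Adj a.1 b.1 then (criticalBeta 3 / 2) * (if hZ a.1 = 0 ∨ hZ b.1 = 0 then J else 1) else 0; let twinLat : ℝ → (k : ℕ) → (Fin k → Site 3) → ℝ := fun J _k z => ⨆ L : ℕ, PairIsing.gibbsAvg (cpl J L) (fun s => ∏ i, if h : z i ∈ box 3 L then spinAt (⟨z i, h⟩ : ↥(box 3 L)) s else 0); let LRO : ℝ → Prop := fun J => ∃ m : ℝ, 0 < m ∧ ∀ c : Site 3, hZ c = 0 → m ≤ twinLat J 2 ![0, c]; (∃ J : ℝ, 0 < J ∧ ¬ LRO J) ∧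
        ∀ J : ℝ, 0 ≤ J → (∀ J' : ℝ, J < J' → LRO J') → (∀ J' : ℝ, 0 ≤ J' → J' < J → ¬ LRO J') → ¬ LRO J) := by
  have hM := stub_seamMonotone
  have hS := stub_strongSeamOrder
  change ∀ J J' : ℝ, 0 ≤ J → J ≤ J' → ∀ c : Site 3, PlaneSummable.twinLat J 2 ![0, c] ≤ PlaneSummable.twinLat J' 2 ![0, c] at hM
  change ∃ J : ℝ, 0 ≤ J ∧ ∃ m : ℝ, 0 < m ∧ ∀ c : Site 3, c 0 + c 1 + c 2 = 0 → m ≤ PlaneSummable.twinLat J 2 ![0, c] at hS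
  change (∃ J : ℝ, 0 < J ∧ (¬ ∃ m : ℝ, 0 < m ∧ ∀ c : Site 3, c 0 + c 1 + c 2 = 0 → m ≤ PlaneSummable.twinLat J 2 ![0, c]) ∧
      ∀ J' : ℝ, J < J' → ∃ m : ℝ, 0 < m ∧ ∀ c : Site 3, c 0 + c 1 + c 2 = 0 → m ≤ PlaneSummable.twinLat J' 2 ![0, c]) ↔
    ((∃ J : ℝ, 0 < J ∧ ¬ ∃ m : ℝ, 0 < m ∧ ∀ c : Site 3, c 0 + c 1 + c 2 = 0 → m ≤ PlaneSummable.twinLat J 2 ![0, c]) ∧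
      ∀ J : ℝ, 0 ≤ J →
        (∀ J' : ℝ, J < J' → ∃ m : ℝ, 0 < m ∧ ∀ c : Site 3, c 0 + c 1 + c 2 = 0 → m ≤ PlaneSummable.twinLat J' 2 ![0, c]) →
        (∀ J' : ℝ, 0 ≤ J' → J' < J → ¬ ∃ m : ℝ, 0 < m ∧ ∀ c : Site 3, c 0 + c 1 + c 2 = 0 → m ≤ PlaneSummable.twinLat J' 2 ![0, c]) →
        ¬ ∃ m : ℝ, 0 < m ∧ ∀ c : Site 3, c 0 + c 1 + c 2 = 0 → m ≤ PlaneSummable.twinLat J 2 ![0, c])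
  refine posContinuousThreshold_iff
    (P := fun J => ∃ m : ℝ, 0 < m ∧ ∀ c : Site 3, c 0 + c 1 + c 2 = 0 → m ≤ PlaneSummable.twinLat J 2 ![0, c]) ?_ hS
  rintro J J' hJ hJJ' ⟨m, hm, hle⟩
  exact ⟨m, hm, fun c hc => (hle c hc).trans (hM J J' hJ hJJ' c)⟩

end Summit.CriticalPhenomena.Ising3DConformalLimit.Cruxes.TwinThreshold.SeamRenewal

end
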